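import Mathlib.Probability.ProbabilityMassFunction.Constructions
import Literature.Computability.Cryptography.Indistinguishability
import Literature.Computability.MetaComplexity.ProofSystems
import Literature.Computability.Complexity.PairingMachines
import Literature.Computability.Complexity.PairProjections
import Literature.Computability.Complexity.RandomizedProofs
import HarnessLib

/-!
# One-message proof systems in the plain model: NIWI ("non-interactive zaps") and witness hiding

A *one-message* (non-interactive) proof system for a binary relation `R ⊆ {0,1}* × {0,1}*` in the
*plain model* — no common reference / random string, no set-up, no interaction — is a pair
`(P, V)`: a randomized prover `P` that, on a statement `x` and a witness `w` with `R x w`, outputs a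
single proof string `π ← P(x, w)`, and a *deterministic* polynomial-time verifier `V x π ∈ {0,1}`.
When it is perfectly complete and perfectly sound, Barak–Ong–Vadhan call it an *NP proof system*
("a single message from the prover to the verifier, … both perfect completeness and perfect
soundness, and … a deterministic verifier. The prover, however, is allowed to be probabilistic
polynomial time given a witness"; BOV 2007, §3.1); Dwork–Naor obtain the non-uniform version from
any zap (Dwork–Naor 2000, §3, Claim 3.1); a computationally witness-indistinguishable one is a
*non-interactive zap* (Groth–Ostrovsky–Sahai 2006, §2.1).

Contents (bit strings throughout; pairs presented through `boolPair`; a security parameter, where an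
adversary needs one, is handed over in unary as in `Indistinguishability.lean`): witness relations
(`witnessLanguage`, `IsNPRelation`, `HasUniqueWitnesses`); the structure `OneMessageProofSystem` =
`(prove, verify)` with `proofPMF`, `IsEfficient`, `IsPerfectlyComplete R`, `IsPerfectlySound R`,
`IsNPProofSystemFor R` (BOV 2007, §3.1) and `acceptLanguage` (accepted pairs `⟨x, π⟩`, in `P`);
the hiding predicates `IsNIWI R`, `IsNIWINonuniform R`, `IsPerfectlyNIWI R` (witness
indistinguishability) and `IsHardInstanceEnsemble R XW`, `IsNIWH R XW` (witness hiding); API lemmas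
(support/coins form of completeness, the link to Cook–Reckhow systems
`MetaComplexity.IsProofSystemFor`, `acceptLanguage_mem_P`, vacuity of WI for unique witnesses) and
the trivial NP proof system `sendWitness V` (send the witness; BOV 2007, §3).

## Design choices

* The structure bundles only the two algorithms (as `SignatureScheme`, `BitCommitment` in
  `CommitmentsSignatures.lean`); completeness, soundness, efficiency and the hiding properties are
  separate predicates taking the relation `R : List Bool → List Bool → Prop` as an argument, so
  that the same pair can be discussed w.r.t. several relations and variants (arguments =
  computational soundness, imperfect completeness) can be added without a new structure.
* No security parameter is given to `P`/`V` beyond the statement itself (BOV 2007, §3.1;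
  Dwork–Naor 2000, §3: "polynomial time (in `n = |x|`)"). GOS 2006, §2.1 instead hand `1ᵏ` to the
  prover and let a non-uniform adversary choose `(x, w₁, w₂)` given `1ᵏ`; that variant is not
  formalised separately.
* Perfect completeness is stated through the support of `proofPMF` ("probability `1`", GOS 2006,
  §2); `isPerfectlyComplete_iff` rewrites it as "for every coin string of the prescribed length".
* Witness indistinguishability. Print indexes the ensembles by the statement: "for all sufficiently
  long `x ∈ L`", advantage `< 1/p(|x|)`, distinguisher given `(x, z, proof)` where "`z` may equal
  `(w¹ₓ, w²ₓ)`" (Goldreich 2001, Def. 4.6.1; Dwork–Naor 2000, Def. 2.1: the distinguisher receives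
  "`(x, w₁, w₂, z)`"). The tree's `IsCompIndistinguishable` is indexed by `n : ℕ`; we therefore
  quantify over *sequences* `(xₙ, w⁰ₙ, w¹ₙ)` of statements with two witnesses and `n ≤ |xₙ|`
  (the security parameter never exceeds the statement length, so "negligible in `n` against
  time `poly(n + |xₙ|)`" is "negligible in `|x|` against time `poly(|x|)`" along the sequence), and
  hand the distinguisher the sample `⟨xₙ, ⟨w⁰ₙ, ⟨w¹ₙ, π⟩⟩⟩`. `IsNIWI` uses uniform PPT
  distinguishers (the tree's default, as `BitCommitment.IsComputationallyHiding`), which is implied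
  by the printed non-uniform notion `IsNIWINonuniform` (polynomial advice, Goldreich 2001,
  Def. 3.2.3-style; Dwork–Naor 2000, §3; BOV 2007, Def. 3.1).
* Witness hiding is Goldreich's Def. 4.6.5 for a one-message prover: the malicious verifier is a
  PPT witness finder `A(1ⁿ, ⟨x, π⟩)`; the instance ensemble is a *joint* ensemble
  `XW n : PMF ({0,1}* × {0,1}*)` of (statement, witness) pairs ("`Yₙ` arbitrarily distributed over
  `R_L(Xₙ)`"), indexed by the security parameter `n` given to the adversary in unary rather than by
  `|x| = n` (Goldreich normalises `Xₙ` to range over `L ∩ {0,1}ⁿ`; the tree's ensembles range over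
  statements of length `poly(n)`). Hardness of the ensemble (Def. 4.6.4) is the separate predicate
  `IsHardInstanceEnsemble`, a hypothesis of witness-hiding statements, not part of the definition.
* Deliberately NOT here: existence theorems for NIWI proof systems for all of `NP` — from the
  decision linear assumption on bilinear groups (GOS 2006, Thm. 3), from indistinguishability
  obfuscation and one-way permutations (Bitansky–Paneth 2015), from hitting-set generators against
  co-nondeterministic circuits plus trapdoor permutations (BOV 2007, Thm. 3.4) — and the one-message
  witness-hiding constructions of Kuykendall–Zhandry 2020: their hypotheses (bilinear groups, iO,
  HSGs) have no formalisation in the tree yet, so they are not vendored as named facts here.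
  Mathlib has no proof systems, witness indistinguishability or witness hiding (searched
  `WitnessIndist`, `Zap`, `NIWI`, `ProofSystem`); tree anchors reused: `RandAlg` (`outputPMF`,
  `IsPolyTime`), `IsPPT`, `Ensemble`, `IsCompIndistinguishable(Nonuniform)`,
  `MetaComplexity.IsPolyTimeVerifier/IsProofSystemFor`, `Classes.P`, `boolPair`/`boolUnpair`,
  `polyTimeComputable_boolUnpair`, `PolyTimeComputable.comp_holds`.

## References

* B. Barak, S. J. Ong, S. Vadhan, *Derandomization in cryptography*, SIAM J. Comput. 37 (2007),
  §2.2 Def. 2.3 (interactive proofs, perfect completeness/soundness, "one round is called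
  noninteractive"), §3.1 (witness relations, NP proof systems, efficient provers, Def. 3.1 WI), Thm. 3.4.
* C. Dwork, M. Naor, *Zaps and their applications*, FOCS 2000 (full version SIAM J. Comput. 36
  (2007)): Def. 2.1 (WI), §3 (formal definition of a zap), Claim 3.1 (one-message non-uniform WI).
* J. Groth, R. Ostrovsky, A. Sahai, *Non-interactive zaps and new techniques for NIZK*, CRYPTO 2006,
  §2 (perfect completeness, perfect soundness), §2.1 (computational/perfect WI, non-interactive zaps).
* O. Goldreich, *Foundations of Cryptography I*, CUP 2001, §4.6.1 (witness relations; Def. 4.6.1 WI;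
  Def. 4.6.4 hard-instance ensembles; Def. 4.6.5 witness hiding), §4.6.1.1 (unique witnesses).
* U. Feige, A. Shamir, *Witness indistinguishable and witness hiding protocols*, STOC 1990.
* N. Bitansky, O. Paneth, TCC 2015; B. Kuykendall, M. Zhandry, TCC 2020 (constructions, not formalised).
-/

namespace Literature.Computability.Cryptography

open Filter Asymptotics _root_.Computability Complexity MetaComplexity

/-! ### Witness relations -/

/-- The language of a binary relation on strings: `L_R = {x | ∃ w, R x w}` (the statements that
have a witness). [Goldreich 2001, §4.6.1 (`L = {x : ∃ y s.t. (x, y) ∈ R_L}`); Groth–Ostrovsky–Sahai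
2006, §2 ("Let `L` be the language consisting of statements in `R`")] [cite: Goldreich2001FoC1, §4.6.1] -/
def witnessLanguage (R : List Bool → List Bool → Prop) : Language Bool :=
  {x | ∃ w, R x w}

/-- `IsNPRelation R`: `R` is an `NP` (witness) relation — polynomially bounded (`R x w` implies
`|w| ≤ p(|x|)`) and polynomial-time recognizable (some polynomial-time verifier `V` on `⟨x, w⟩`
decides it). [Goldreich 2001, §4.6.1 ("a witness relation … is polynomially bounded …, is
polynomial-time-recognizable"); Barak–Ong–Vadhan 2007, §3.1] [cite: Goldreich2001FoC1, §4.6.1] -/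
def IsNPRelation (R : List Bool → List Bool → Prop) : Prop :=
  (∃ p : Polynomial ℕ, ∀ x w, R x w → w.length ≤ p.eval x.length) ∧
    ∃ V : List Bool → List Bool → Bool, IsPolyTimeVerifier V ∧ ∀ x w, V x w = true ↔ R x w

/-- `HasUniqueWitnesses R`: every statement has at most one witness. [Goldreich 2001, §4.6.1.1
("any proof system for a language having unique witnesses is trivially witness-indistinguishable")] [cite: Goldreich2001FoC1, §4.6.1.1] -/
def HasUniqueWitnesses (R : List Bool → List Bool → Prop) : Prop :=
  ∀ x w w', R x w → R x w' → w = w'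

/-! ### One-message proof systems -/

/-- A *one-message proof system* (candidate) in the plain model: a randomized prover `prove`, run on
the pair `(x, w)` (statement, witness) and producing the single message `π`, and a deterministic
verifier `verify x π`. Completeness, soundness, efficiency and hiding are the predicates below.
[Barak–Ong–Vadhan 2007, §3.1 (NP proof systems); Dwork–Naor 2000, §3, Claim 3.1; Groth–Ostrovsky–Sahai
2006, §2–2.1 (with trivial CRS generation)] [cite: BarakOngVadhan2007, §3.1] -/
structure OneMessageProofSystem where
  /-- The prover `P(x, w; r) = π` (input pair presented as `boolPair x w`, coins `r`). -/
  prove : RandAlg (List Bool × List Bool) (List Bool)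
  /-- The deterministic verifier `V(x, π) ∈ {0,1}`. -/
  verify : List Bool → List Bool → Bool

namespace OneMessageProofSystem

/-- The input presentation of the prover (and of the verifier): `(x, y) ↦ ⟨x, y⟩ = boolPair x y`.
[Arora–Barak 2009, §0.1 (pairing); Barak–Ong–Vadhan 2007, §3.1] [cite: BarakOngVadhan2007, §3.1] -/
def proverCode (p : List Bool × List Bool) : List Bool :=
  boolPair p.1 p.2

/-- `PS.proofPMF x w`: the law of the proof `π ← P(x, w)` (uniform coins of the prescribed length
`coinLen |⟨x, w⟩|`). [Groth–Ostrovsky–Sahai 2006, §2 (`π ← P(σ, x, w)`); Barak–Ong–Vadhan 2007, §3.1] [cite: GrothOstrovskySahai2006, §2] -/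
noncomputable def proofPMF (PS : OneMessageProofSystem) (x w : List Bool) : PMF (List Bool) :=
  PS.prove.outputPMF proverCode (x, w)

/-- `PS.IsEfficient`: the prover is PPT on `⟨x, w⟩` (given a witness: an *efficient prover*) and the
verifier is deterministic polynomial-time on `⟨x, π⟩` (`MetaComplexity.IsPolyTimeVerifier`, time
measured in `|⟨x, π⟩|`, the Cook–Reckhow convention; honest proofs have length `poly(|⟨x, w⟩|)`
because the prover is PPT). [Barak–Ong–Vadhan 2007, §3.1 ("efficient provers"; "(c) has a
deterministic verifier"), §2.2 Def. 2.3 (efficiency); Groth–Ostrovsky–Sahai 2006, §2] [cite: BarakOngVadhan2007, §3.1] -/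
def IsEfficient (PS : OneMessageProofSystem) : Prop :=
  PS.prove.IsPolyTime proverCode (id : List Bool → List Bool) ∧ IsPolyTimeVerifier PS.verify

/-- `PS.IsPerfectlyComplete R`: perfect completeness — for every `(x, w) ∈ R`, *every* proof in the
range of `P(x, w)` is accepted (`Pr[V(x, P(x, w)) = 1] = 1`). [Groth–Ostrovsky–Sahai 2006, §2
(perfect completeness); Barak–Ong–Vadhan 2007, §2.2 and §3.1 (b); Dwork–Naor 2000, §3] [cite: GrothOstrovskySahai2006, §2] -/
def IsPerfectlyComplete (PS : OneMessageProofSystem) (R : List Bool → List Bool → Prop) : Prop :=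
  ∀ x w, R x w → ∀ π ∈ (PS.proofPMF x w).support, PS.verify x π = true

/-- `PS.IsPerfectlySound R`: perfect soundness — against computationally *unbounded* provers and
with no error: if `V(x, π) = 1` for some string `π` then `x ∈ L_R`, i.e. no statement outside `L_R`
has an accepted proof. [Groth–Ostrovsky–Sahai 2006, §2 (perfect soundness, "for all adversaries");
Barak–Ong–Vadhan 2007, §2.2 ("perfect soundness if the soundness condition holds with probability
0") and §3.1 (b); Dwork–Naor 2000, Claim 3.1 (2)] [cite: GrothOstrovskySahai2006, §2] -/
def IsPerfectlySound (PS : OneMessageProofSystem) (R : List Bool → List Bool → Prop) : Prop :=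
  ∀ x π, PS.verify x π = true → ∃ w, R x w

/-- `PS.IsNPProofSystemFor R`: `PS` is an *NP proof system* for `R` with an efficient prover —
efficient, perfectly complete and perfectly sound. [Barak–Ong–Vadhan 2007, §3.1 (NP proof systems,
efficient provers)] [cite: BarakOngVadhan2007, §3.1] -/
def IsNPProofSystemFor (PS : OneMessageProofSystem) (R : List Bool → List Bool → Prop) : Prop :=
  PS.IsEfficient ∧ PS.IsPerfectlyComplete R ∧ PS.IsPerfectlySound R

/-- `PS.acceptLanguage`: the set of accepted pairs, `{z | V (boolUnpair z).1 (boolUnpair z).2 = 1}`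
(so `boolPair x π ∈ PS.acceptLanguage ↔ V x π = 1`); the witness relation *induced* by the system.
[Barak–Ong–Vadhan 2007, §3.1 ("an NP proof system for a language `L` induces a witness relation … by
setting `W(x)` to contain all the prover messages accepted by the verifier")] [cite: BarakOngVadhan2007, §3.1] -/
def acceptLanguage (PS : OneMessageProofSystem) : Language Bool :=
  {z | PS.verify (boolUnpair z).1 (boolUnpair z).2 = true}

/-! ### Witness indistinguishability -/

/-- `PS.wiEnsemble x w₀ w₁ w`: along the sequence of statements `x n` with the two witnesses
`w₀ n`, `w₁ n`, the ensemble of samples `⟨x n, ⟨w₀ n, ⟨w₁ n, π⟩⟩⟩` with `π ← P(x n, w n)` — the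
distinguisher's input "(the proof) as well as `(x, w₁, w₂)`". [Dwork–Naor 2000, Def. 2.1; Goldreich
2001, Def. 4.6.1 ("`z` may equal `(w¹ₓ, w²ₓ)`")] [cite: DworkNaor2000, Def. 2.1] -/
noncomputable def wiEnsemble (PS : OneMessageProofSystem) (x w₀ w₁ w : ℕ → List Bool) :
    Ensemble (List Bool) :=
  fun n => (PS.proofPMF (x n) (w n)).map fun π => boolPair (x n) (boolPair (w₀ n) (boolPair (w₁ n) π))

/-- `PS.IsNIWI R`: (computational) *witness indistinguishability* of the one-message system — for
every sequence of statements `x n` with `n ≤ |x n|` and every two sequences of witnesses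
`w₀ n, w₁ n ∈ R(x n)`, the proofs computed from `w₀` and from `w₁` (handed over together with
`x n, w₀ n, w₁ n`) are computationally indistinguishable (`IsCompIndistinguishable`: negligible
advantage in `n` for every uniform PPT distinguisher; the printed notion quantifies over non-uniform
distinguishers, see `IsNIWINonuniform`). A NIWI proof = a *non-interactive zap*. [Goldreich 2001,
Def. 4.6.1; Dwork–Naor 2000, Def. 2.1 and §3 (WI "in `n = |x|`"), Claim 3.1 (3); Barak–Ong–Vadhan
2007, Def. 3.1; Groth–Ostrovsky–Sahai 2006, §2.1] [cite: Goldreich2001FoC1, Def. 4.6.1] -/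
def IsNIWI (PS : OneMessageProofSystem) (R : List Bool → List Bool → Prop) : Prop :=
  ∀ x w₀ w₁ : ℕ → List Bool, (∀ n, n ≤ (x n).length) → (∀ n, R (x n) (w₀ n)) →
    (∀ n, R (x n) (w₁ n)) →
      IsCompIndistinguishable (PS.wiEnsemble x w₀ w₁ w₀) (PS.wiEnsemble x w₀ w₁ w₁)

/-- `PS.IsNIWINonuniform R`: witness indistinguishability against *non-uniform* polynomial-time
distinguishers (PPT with polynomial advice, `IsCompIndistinguishableNonuniform`), the form printed in
the sources. [Dwork–Naor 2000, §3 ("nonuniform probabilistic polynomial time (in `n = |x|`)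
indistinguishable"); Barak–Ong–Vadhan 2007, Def. 3.1; Goldreich 2001, Def. 4.6.1 with Def. 3.2.3] [cite: DworkNaor2000, §3] -/
def IsNIWINonuniform (PS : OneMessageProofSystem) (R : List Bool → List Bool → Prop) : Prop :=
  ∀ x w₀ w₁ : ℕ → List Bool, (∀ n, n ≤ (x n).length) → (∀ n, R (x n) (w₀ n)) →
    (∀ n, R (x n) (w₁ n)) →
      IsCompIndistinguishableNonuniform (PS.wiEnsemble x w₀ w₁ w₀) (PS.wiEnsemble x w₀ w₁ w₁)

/-- `PS.IsPerfectlyNIWI R`: *perfect* witness indistinguishability (witness independence) — for every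
statement with two witnesses the two proof distributions coincide. [Groth–Ostrovsky–Sahai 2006,
§2.1 ("perfect WI … equality of the above probabilities for all adversaries"); Goldreich 2001,
Def. 4.6.1 (witness-independent: "identically distributed")] [cite: GrothOstrovskySahai2006, §2.1] -/
def IsPerfectlyNIWI (PS : OneMessageProofSystem) (R : List Bool → List Bool → Prop) : Prop :=
  ∀ x w₀ w₁, R x w₀ → R x w₁ → PS.proofPMF x w₀ = PS.proofPMF x w₁

/-! ### Witness hiding -/

end OneMessageProofSystem

/-- `witnessSearchPMF F n X`: the joint law of `(x, w')` where `(x, w) ← X` and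
`w' ← F(1ⁿ, x)` — a witness finder working *from scratch*. [Goldreich 2001, Def. 4.6.4
(`F(Xₙ, z) ∈ R_L(Xₙ)`)] [cite: Goldreich2001FoC1, Def. 4.6.4] -/
noncomputable def witnessSearchPMF (F : RandAlg (List Bool) (List Bool)) (n : ℕ)
    (X : PMF (List Bool × List Bool)) : PMF (List Bool × List Bool) :=
  X.bind fun xw => (F.outputPMF id (boolPair (unaryEncodeNat n) xw.1)).map (Prod.mk xw.1)

/-- `IsHardInstanceEnsemble R XW`: the joint ensemble `XW n` of (statement, witness) pairs ranges
over `R`, and finding a witness from the statement alone is infeasible — for every PPT `F`,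
`n ↦ Pr[(x, w) ← XW n; w' ← F(1ⁿ, x) : R x w']` is negligible. [Goldreich 2001, Def. 4.6.4
(distribution of hard instances) and §4.6.1.2 remark 2 (joint ensembles)] [cite: Goldreich2001FoC1, Def. 4.6.4] -/
def IsHardInstanceEnsemble (R : List Bool → List Bool → Prop)
    (XW : ℕ → PMF (List Bool × List Bool)) : Prop :=
  (∀ n, ∀ xw ∈ (XW n).support, R xw.1 xw.2) ∧
    ∀ F : RandAlg (List Bool) (List Bool), IsPPT F id →
      SuperpolynomialDecay atTop (fun n : ℕ => (n : ℝ)) fun n =>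
        ((witnessSearchPMF F n (XW n)).toOuterMeasure {p | R p.1 p.2}).toReal

namespace OneMessageProofSystem

/-- `PS.findWitnessPMF A n X`: the joint law of `(x, w')` in the witness-hiding experiment —
`(x, w) ← X`, `π ← P(x, w)`, `w' ← A(1ⁿ, ⟨x, π⟩)` (the verifier-side adversary sees the statement
and the single prover message). [Goldreich 2001, Def. 4.6.5 (`⟨P(Yₙ), V*(z)⟩(Xₙ) ∈ R_L(Xₙ)`);
Feige–Shamir 1990] [cite: Goldreich2001FoC1, Def. 4.6.5] -/
noncomputable def findWitnessPMF (PS : OneMessageProofSystem) (A : RandAlg (List Bool) (List Bool))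
    (n : ℕ) (X : PMF (List Bool × List Bool)) : PMF (List Bool × List Bool) :=
  X.bind fun xw => (PS.proofPMF xw.1 xw.2).bind fun π =>
    (A.outputPMF id (boolPair (unaryEncodeNat n) (boolPair xw.1 π))).map (Prod.mk xw.1)

/-- `PS.findWitnessProb R XW A n = Pr[(x, w) ← XW n; π ← P(x, w); w' ← A(1ⁿ, ⟨x, π⟩) : R x w']`,
the success probability of the witness finder `A` after seeing the proof. [Goldreich 2001,
Def. 4.6.5] [cite: Goldreich2001FoC1, Def. 4.6.5] -/
noncomputable def findWitnessProb (PS : OneMessageProofSystem) (R : List Bool → List Bool → Prop)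
    (XW : ℕ → PMF (List Bool × List Bool)) (A : RandAlg (List Bool) (List Bool)) (n : ℕ) : ℝ :=
  ((PS.findWitnessPMF A n (XW n)).toOuterMeasure {p | R p.1 p.2}).toReal

/-- `PS.IsNIWH R XW`: the one-message system is *witness hiding* for `R` under the (statement,
witness) ensemble `XW` — for every PPT adversary `A`, the probability of computing *some* witness for
`x` from `(1ⁿ, ⟨x, π⟩)` is negligible in `n`. Meaningful only when `XW` is a hard-instance ensemble
(`IsHardInstanceEnsemble`), which witness-hiding statements take as a hypothesis. Uniform PPT
adversaries (the tree's default); the printed definition also lets the verifier hold an arbitrary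
auxiliary input `z`. [Goldreich 2001, Def. 4.6.5 (witness hiding under an instance ensemble);
Feige–Shamir 1990; one-message setting: Kuykendall–Zhandry 2020] [cite: Goldreich2001FoC1, Def. 4.6.5] -/
def IsNIWH (PS : OneMessageProofSystem) (R : List Bool → List Bool → Prop)
    (XW : ℕ → PMF (List Bool × List Bool)) : Prop :=
  ∀ A : RandAlg (List Bool) (List Bool), IsPPT A id →
    SuperpolynomialDecay atTop (fun n : ℕ => (n : ℝ)) (PS.findWitnessProb R XW A)

/-! ### API -/

/-- The proofs in the range of `P(x, w)` are exactly the outputs on coin strings of the prescribed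
length `coinLen |⟨x, w⟩|`. [Arora–Barak 2009, §7.1 (PTM = deterministic TM with a random tape)] [folklore] -/
theorem mem_support_proofPMF_iff (PS : OneMessageProofSystem) (x w π : List Bool) :
    π ∈ (PS.proofPMF x w).support ↔
      ∃ r : List Bool, r.length = PS.prove.coinLen (boolPair x w).length ∧ PS.prove.run (x, w) r = π := by
  unfold proofPMF RandAlg.outputPMF
  rw [PMF.mem_support_map_iff]
  constructor
  · rintro ⟨r, -, rfl⟩
    exact ⟨r.toList, by simp [proverCode], rfl⟩
  · rintro ⟨r, hr, rfl⟩
    exact ⟨⟨r, by simpa [proverCode] using hr⟩, PMF.mem_support_uniformOfFintype _, rfl⟩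

/-- Perfect completeness in the "for all coins" form: `R x w → V(x, P(x, w; r)) = 1` for every coin
string `r` of the prescribed length. [Groth–Ostrovsky–Sahai 2006, §2; Dwork–Naor 2000, §3] [cite: GrothOstrovskySahai2006, §2] -/
theorem isPerfectlyComplete_iff (PS : OneMessageProofSystem) (R : List Bool → List Bool → Prop) :
    PS.IsPerfectlyComplete R ↔ ∀ x w, R x w → ∀ r : List Bool,
      r.length = PS.prove.coinLen (boolPair x w).length → PS.verify x (PS.prove.run (x, w) r) = true :=
  ⟨fun h x w hxw r hr => h x w hxw _ ((PS.mem_support_proofPMF_iff x w _).2 ⟨r, hr, rfl⟩),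
    fun h x w hxw π hπ => by
      obtain ⟨r, hr, rfl⟩ := (PS.mem_support_proofPMF_iff x w π).1 hπ
      exact h x w hxw r hr⟩

/-- Membership in the accept language of a well-formed pair is acceptance. [Barak–Ong–Vadhan 2007,
§3.1] [cite: BarakOngVadhan2007, §3.1] -/
@[simp] theorem boolPair_mem_acceptLanguage (PS : OneMessageProofSystem) (x π : List Bool) :
    boolPair x π ∈ PS.acceptLanguage ↔ PS.verify x π = true := by
  change PS.verify (boolUnpair (boolPair x π)).1 (boolUnpair (boolPair x π)).2 = true ↔ _
  rw [boolUnpair_boolPair]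

/-- Under perfect completeness and perfect soundness, `L_R` is exactly the set of statements with
an accepted proof. [Barak–Ong–Vadhan 2007, §3.1; Dwork–Naor 2000, Claim 3.1 (1)–(2)] [cite: BarakOngVadhan2007, §3.1] -/
theorem witnessLanguage_eq_of_complete_of_sound {PS : OneMessageProofSystem}
    {R : List Bool → List Bool → Prop} (hc : PS.IsPerfectlyComplete R) (hs : PS.IsPerfectlySound R) :
    witnessLanguage R = {x | ∃ π, PS.verify x π = true} := by
  ext x
  constructor
  · rintro ⟨w, hw⟩
    obtain ⟨π, hπ⟩ := (PS.proofPMF x w).support_nonempty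
    exact ⟨π, hc x w hw π hπ⟩
  · rintro ⟨π, hπ⟩
    exact hs x π hπ

/-- An NP proof system for `R` is a Cook–Reckhow proof system (verifier form,
`MetaComplexity.IsProofSystemFor`) for the language `L_R`. [Barak–Ong–Vadhan 2007, §3.1 ("we call
this an NP proof system … as is the case in the trivial NP proof"); Cook–Reckhow 1979, §1] [cite: BarakOngVadhan2007, §3.1] -/
theorem IsNPProofSystemFor.isProofSystemFor_witnessLanguage {PS : OneMessageProofSystem}
    {R : List Bool → List Bool → Prop} (h : PS.IsNPProofSystemFor R) :
    MetaComplexity.IsProofSystemFor PS.verify (witnessLanguage R) := by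
  refine ⟨h.1.2, fun x => ?_⟩
  rw [witnessLanguage_eq_of_complete_of_sound h.2.1 h.2.2]
  rfl

/-- **The accept language is in `P`.** If the verifier is polynomial-time on `⟨x, π⟩`, then
`{z | V (boolUnpair z).1 (boolUnpair z).2 = 1} ∈ P` (the certification language `{⟨x, π⟩ : V accepts}`):
compose the verifier's machine after the re-pairing machine `polyTimeComputable_boolUnpair`.
[Barak–Ong–Vadhan 2007, §3.1 (deterministic polynomial-time verifier); Arora–Barak 2009, Def. 1.13] [cite: BarakOngVadhan2007, §3.1] -/
theorem acceptLanguage_mem_P (PS : OneMessageProofSystem) (hV : IsPolyTimeVerifier PS.verify) :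
    PS.acceptLanguage ∈ Classes.P := by
  refine mem_P_iff_holds.2 (polyTimeDecidable_iff.2 ?_)
  have hcomp : PolyTimeComputable (id : List Bool → List Bool) encodeBool
      (Function.uncurry PS.verify ∘ boolUnpair) :=
    PolyTimeComputable.comp_holds hV polyTimeComputable_boolUnpair
  have hind : PS.acceptLanguage.boolIndicator = Function.uncurry PS.verify ∘ boolUnpair := by
    funext z
    by_cases hz : Function.uncurry PS.verify (boolUnpair z) = true
    · rw [(Set.mem_iff_boolIndicator PS.acceptLanguage z).1 hz]; exact hz.symm
    · rw [(Set.notMem_iff_boolIndicator PS.acceptLanguage z).1 hz, Function.comp_apply,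
        Bool.eq_false_iff.2 hz]
  exact hind ▸ hcomp

/-- For an efficient system the accept language is in `P`. [Barak–Ong–Vadhan 2007, §3.1] [cite: BarakOngVadhan2007, §3.1] -/
theorem IsEfficient.acceptLanguage_mem_P {PS : OneMessageProofSystem} (h : PS.IsEfficient) :
    PS.acceptLanguage ∈ Classes.P :=
  PS.acceptLanguage_mem_P h.2

/-- WI along a sequence with equal witnesses is automatic, and in particular **witness
indistinguishability is vacuous for unique-witness relations**: the two ensembles coincide.
[Goldreich 2001, §4.6.1.1 ("any proof system for a language having unique witnesses is trivially
witness-indistinguishable")] [cite: Goldreich2001FoC1, §4.6.1.1] -/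
theorem IsNIWI.of_hasUniqueWitnesses {R : List Bool → List Bool → Prop} (hR : HasUniqueWitnesses R)
    (PS : OneMessageProofSystem) : PS.IsNIWI R := by
  intro x w₀ w₁ _ h₀ h₁
  obtain rfl : w₀ = w₁ := funext fun n => hR _ _ _ (h₀ n) (h₁ n)
  exact IsCompIndistinguishable.refl _

/-- Perfect WI is likewise automatic for unique-witness relations. [Goldreich 2001, §4.6.1.1] [cite: Goldreich2001FoC1, §4.6.1.1] -/
theorem IsPerfectlyNIWI.of_hasUniqueWitnesses {R : List Bool → List Bool → Prop}
    (hR : HasUniqueWitnesses R) (PS : OneMessageProofSystem) : PS.IsPerfectlyNIWI R := by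
  intro x w₀ w₁ h₀ h₁
  rw [hR x w₀ w₁ h₀ h₁]

/-- Perfect WI implies computational WI against non-uniform distinguishers: the two ensembles are
*equal*, so every advised distinguisher has advantage `0`. [Groth–Ostrovsky–Sahai 2006, §2.1;
Goldreich 2001, Def. 4.6.1 (witness independence ⇒ witness indistinguishability)] [cite: GrothOstrovskySahai2006, §2.1] -/
theorem IsPerfectlyNIWI.isNIWINonuniform {PS : OneMessageProofSystem} {R : List Bool → List Bool → Prop}
    (h : PS.IsPerfectlyNIWI R) : PS.IsNIWINonuniform R := by
  intro x w₀ w₁ _ h₀ h₁ D _ a _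
  have hE : PS.wiEnsemble x w₀ w₁ w₀ = PS.wiEnsemble x w₀ w₁ w₁ :=
    funext fun n => by simp only [wiEnsemble, h (x n) (w₀ n) (w₁ n) (h₀ n) (h₁ n)]
  have h0 : distAdvantageAdv D a (PS.wiEnsemble x w₀ w₁ w₀) (PS.wiEnsemble x w₀ w₁ w₁) = 0 := by
    funext n; simp [distAdvantageAdv, hE]
  rw [h0]
  exact superpolynomialDecay_zero _ _

/-- Perfect WI implies computational WI (uniform distinguishers). [Groth–Ostrovsky–Sahai 2006, §2.1;
Goldreich 2001, Def. 4.6.1] [cite: GrothOstrovskySahai2006, §2.1] -/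
theorem IsPerfectlyNIWI.isNIWI {PS : OneMessageProofSystem} {R : List Bool → List Bool → Prop}
    (h : PS.IsPerfectlyNIWI R) : PS.IsNIWI R := by
  intro x w₀ w₁ _ h₀ h₁
  have hE : PS.wiEnsemble x w₀ w₁ w₀ = PS.wiEnsemble x w₀ w₁ w₁ :=
    funext fun n => by simp only [wiEnsemble, h (x n) (w₀ n) (w₁ n) (h₀ n) (h₁ n)]
  rw [hE]
  exact IsCompIndistinguishable.refl _

/-! ### The trivial NP proof system: send the witness -/

/-- The *trivial NP proof system* for a Boolean witness relation `V`: the prover sends the witness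
(`P(x, w) = w`, no coins) and the verifier checks `V x π`. [Barak–Ong–Vadhan 2007, §3 ("the trivial
NP proof of simply sending the witness to the verifier")] [cite: BarakOngVadhan2007, §3] -/
def sendWitness (V : List Bool → List Bool → Bool) : OneMessageProofSystem where
  prove := RandAlg.ofDet Prod.snd
  verify := V

/-- The trivial system outputs the witness with probability one. [Barak–Ong–Vadhan 2007, §3] [cite: BarakOngVadhan2007, §3] -/
@[simp] theorem proofPMF_sendWitness (V : List Bool → List Bool → Bool) (x w : List Bool) :
    (sendWitness V).proofPMF x w = PMF.pure w :=
  RandAlg.outputPMF_ofDet _ _ _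

/-- The trivial system is perfectly complete for the relation `V x w = 1`. [Barak–Ong–Vadhan 2007,
§3 and §3.1] [cite: BarakOngVadhan2007, §3] -/
theorem sendWitness_isPerfectlyComplete (V : List Bool → List Bool → Bool) :
    (sendWitness V).IsPerfectlyComplete fun x w => V x w = true := by
  intro x w hw π hπ
  rw [proofPMF_sendWitness, PMF.support_pure, Set.mem_singleton_iff] at hπ
  exact hπ ▸ hw

/-- The trivial system is perfectly sound for the relation `V x w = 1` (an accepted message *is* a
witness). [Barak–Ong–Vadhan 2007, §3 and §3.1] [cite: BarakOngVadhan2007, §3] -/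
theorem sendWitness_isPerfectlySound (V : List Bool → List Bool → Bool) :
    (sendWitness V).IsPerfectlySound fun x w => V x w = true :=
  fun _ π hπ => ⟨π, hπ⟩

/-- The trivial system is efficient as soon as `V` is a polynomial-time verifier: the prover is the
coin-free second projection (`RandAlg.IsPolyTime.ofDet_holds`, `polyTimeComputable_snd_holds`).
[Barak–Ong–Vadhan 2007, §3.1] [cite: BarakOngVadhan2007, §3.1] -/
theorem sendWitness_isEfficient {V : List Bool → List Bool → Bool} (hV : IsPolyTimeVerifier V) :
    (sendWitness V).IsEfficient :=
  ⟨RandAlg.IsPolyTime.ofDet_holds polyTimeComputable_snd_holds, hV⟩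

/-- Hence the trivial system is an NP proof system (with efficient prover) for every polynomial-time
recognizable relation. [Barak–Ong–Vadhan 2007, §3–3.1] [cite: BarakOngVadhan2007, §3.1] -/
theorem sendWitness_isNPProofSystemFor {V : List Bool → List Bool → Bool} (hV : IsPolyTimeVerifier V) :
    (sendWitness V).IsNPProofSystemFor fun x w => V x w = true :=
  ⟨sendWitness_isEfficient hV, sendWitness_isPerfectlyComplete V, sendWitness_isPerfectlySound V⟩

end OneMessageProofSystem

end Literature.Computability.Cryptography
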